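import Mathlib.MeasureTheory.Integral.IntervalIntegral.Periodic
import Literature.Analysis.FluidPDE.OnsagerBDSVPerturbationSmooth
import Literature.Analysis.FunctionSpaces.ParametricIntegralDominated
import Literature.Analysis.FunctionSpaces.TorusAxisAverageCalculus
import HarnessLib

/-!
# Exact periodic primitives on `T³` (tools for the non-stationary phase bound of BDSV Prop. 6.2)

Buckmaster–De Lellis–Székelyhidi–Vicol (BDSV), *Onsager's conjecture for admissible weak
solutions*, CPAM 72 (2019) = arXiv:1701.08678, bound the oscillatory term of the energy (proof of
Prop. 6.2, last paragraph) by expanding the mean-free Mikado tensor `(W ⊗ W - R)(R, ξ)` in a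
Fourier series in `ξ` and applying the stationary-phase estimate (C.1) of Prop. C.2 mode by mode.
The tree proves this bound by the same mechanism — repeated integration by parts against a fast
phase — organised WITHOUT Fourier series: a smooth zero-mean function on `T³` is an exact sum of
coordinate derivatives of smooth zero-mean functions, `u = ∑ⱼ ∂ⱼ (Tⱼ u)`, and each `∂ⱼ`,
evaluated along `ξ = n Φ(x)`, is then traded for `n⁻¹` times `x`-derivatives of the slowly varying
amplitude. This file supplies the first half, the calculus of exact periodic primitives on
`T³ = (ℝ/ℤ)³`, for real functions depending smoothly on a matrix parameter `R ∈ ℝ^{3×3}` (the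
argument of the Mikado profiles):

* the zero-mean periodic primitive `BDSV.circlePrim j g (ξ) = ∫₀¹ (s - ½) g(ξ + s eⱼ) ds`
  along the `j`-th coordinate circle, with the fundamental identity
  `∂ⱼ (circlePrim j g) = g - axisAvg j g` (`BDSV.partialDeriv_circlePrim`), `Torus.axisAvg` being
  the axis average of `FunctionSpaces/TorusAxisAverage.lean` (`∫ g(ξ + s eⱼ) ds` over the Haar
  probability measure of the circle; its interval form `Torus.lift_axisAvg`, its invariance
  `Torus.axisAvg_add_single` and its smoothness `Torus.IsSmooth.axisAvg` are reused);
* the triple average `BDSV.tripleAvg g = axisAvg 2 (axisAvg 1 (axisAvg 0 g))` is the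
  constant `∫_{T³} g` (`BDSV.tripleAvg_eq_integral`: it is invariant under the three coordinate
  translations, hence constant, and `g - tripleAvg g` is a sum of derivatives, whose integrals
  vanish), whence the **telescoping decomposition** of a smooth zero-mean `g`,
  `g = ∑ⱼ ∂ⱼ (torusPrim g j)` (`BDSV.eq_sum_partialDeriv_torusPrim`) with the three smooth
  zero-mean functions `BDSV.torusPrim g j`;
* parametrised smoothness: for `u : ℝ^{3×3} → (T³ → ℝ)` jointly smooth (`BDSV.JointSmooth`), the
  families `R ↦ axisAvg j (u R)`, `circlePrim j (u R)`, `torusPrim (u R) j`, the `ξ`-derivatives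
  `BDSV.dXi k u` and the `R`-derivatives `BDSV.dR E u` are jointly smooth, and `dR E u` has zero
  mean when `u` does (differentiation under the integral sign,
  `FunctionSpaces.fderiv_parametric_integral_apply`).

Everything is elementary calculus (FTC over a period, translation invariance of Haar measure);
no Fourier analysis is used. (The standard basis vectors `BDSV.bvec j = EuclideanSpace.single j 1`
and their few lemmas are kept because the primitive `circlePrim`, its FTC identity and the chain
rule of `OnsagerBDSVNonstationaryPhase.lean` are written along the real lines `ξ + proj (s eⱼ)`;
`Torus.proj_smul_single` bridges to `Pi.single j (s : UnitAddCircle)`.)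

## References

* T. Buckmaster, C. De Lellis, L. Székelyhidi Jr., V. Vicol, *Onsager's conjecture for admissible
  weak solutions*, Comm. Pure Appl. Math. 72 (2019) 229–274 = arXiv:1701.08678: proof of
  Prop. 6.2 (last paragraph), §5.1 (5.6), App. C Prop. C.2 (C.1).
* L. Grafakos, *Classical Fourier Analysis* (3rd ed., 2014), §3.1 (calculus on `Tⁿ` via periodic
  functions).
-/

open MeasureTheory Set Filter
open scoped NNReal ENNReal ContDiff Matrix Matrix.Norms.Elementwise

noncomputable section

namespace Literature.Analysis.FluidPDE

namespace BDSV

open FunctionSpaces FunctionSpaces.Torus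

/-- The flat three-torus `T³ = (ℝ/ℤ)³`, local notation. -/
local notation "𝕋³" => UnitAddTorus (Fin 3)

/-- Euclidean `ℝ³`, local notation. -/
local notation "ℝ³" => EuclideanSpace ℝ (Fin 3)

/-- Real `3 × 3` matrices, local notation. -/
local notation "𝕄" => Matrix (Fin 3) (Fin 3) ℝ

/-! ## Coordinate circles -/

section Circles

/-- The standard basis vector `eⱼ ∈ ℝ³`. [folklore] -/
def bvec (j : Fin 3) : ℝ³ := EuclideanSpace.single j (1 : ℝ)

/-- `eⱼ` projects to `0 ∈ T³` (it is a lattice vector). [folklore] -/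
theorem proj_bvec (j : Fin 3) : proj (bvec j) = 0 := by
  rw [bvec, ← latticeVec_single, proj_latticeVec]

/-- `proj ((s + t) eⱼ) = proj (s eⱼ) + proj (t eⱼ)`. [folklore] -/
theorem proj_add_smul_bvec (j : Fin 3) (s t : ℝ) :
    proj ((s + t) • bvec j) = proj (s • bvec j) + proj (t • bvec j) := by
  rw [add_smul, proj_add]

/-- `proj ((s + 1) eⱼ) = proj (s eⱼ)`: the coordinate circles have period `1`. [folklore] -/
theorem proj_add_one_smul_bvec (j : Fin 3) (s : ℝ) :
    proj ((s + 1) • bvec j) = proj (s • bvec j) := by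
  rw [proj_add_smul_bvec, one_smul, proj_bvec, add_zero]

/-- The restriction of a function on `T³` to the `j`-th coordinate circle through `ξ`,
`r ↦ g(ξ + r eⱼ)`, is `1`-periodic. [folklore] -/
theorem periodic_comp_circle {F : Type*} (g : 𝕋³ → F) (j : Fin 3) (ξ : 𝕋³) :
    Function.Periodic (fun r : ℝ => g (ξ + proj (r • bvec j))) 1 := fun r => by
  simp only [proj_add_one_smul_bvec]

/-- The restriction of a continuous function to a coordinate circle is continuous. [folklore] -/
theorem continuous_comp_circle {F : Type*} [TopologicalSpace F] {g : 𝕋³ → F} (hg : Continuous g)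
    (j : Fin 3) (ξ : 𝕋³) : Continuous fun r : ℝ => g (ξ + proj (r • bvec j)) :=
  hg.comp (continuous_const.add (continuous_proj.comp (continuous_id.smul continuous_const)))

/-- Every `v ∈ ℝ³` is `∑ⱼ vⱼ eⱼ`. [folklore] -/
theorem eq_sum_smul_bvec (v : ℝ³) : v = ∑ j, v j • bvec j := by
  ext i
  simp [bvec, Fin.sum_univ_three, PiLp.single_apply]
  fin_cases i <;> simp

end Circles

/-! ## Circle averages and zero-mean primitives -/

section Operators

/-- The axis average along the real line `ξ + proj (s eⱼ)`: `axisAvg j g ξ = ∫₀¹ g(ξ + s eⱼ) ds`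
(`Torus.lift_axisAvg` at a point of `T³`). [folklore] -/
theorem axisAvg_eq_intervalIntegral (j : Fin 3) (g : 𝕋³ → ℝ) (ξ : 𝕋³) :
    axisAvg j g ξ = ∫ s in (0 : ℝ)..1, g (ξ + proj (s • bvec j)) := by
  rw [axisAvg_apply, integral_unitAddCircle_eq_intervalIntegral]
  refine intervalIntegral.integral_congr fun σ _ => ?_
  simp only [bvec, proj_smul_single]

/-- **Zero-mean periodic primitive along the `j`-th coordinate circle**,
`(P_j g)(ξ) = ∫₀¹ (s - ½) g(ξ + s eⱼ) ds`: for `1`-periodic `φ`, `x ↦ ∫₀¹ (s - ½) φ(x + s) ds` is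
the `1`-periodic function with derivative `φ - ∫₀¹ φ`. [folklore] -/
def circlePrim (j : Fin 3) (g : 𝕋³ → ℝ) (ξ : 𝕋³) : ℝ :=
  ∫ s in (0 : ℝ)..1, (s - 1 / 2) * g (ξ + proj (s • bvec j))

/-- The triple axis average `A₂ A₁ A₀ g` (`A_j = Torus.axisAvg j`) — the constant function
`∫_{T³} g` (`BDSV.tripleAvg_eq_integral`). [folklore] -/
def tripleAvg (g : 𝕋³ → ℝ) : 𝕋³ → ℝ :=
  axisAvg 2 (axisAvg 1 (axisAvg 0 g))

/-- **The three zero-mean primitives of the telescoping decomposition**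
`g - ∫g = ∂₀ P₀ g + ∂₁ P₁ A₀ g + ∂₂ P₂ A₁ A₀ g`: `T₀ g = P₀ g`, `T₁ g = P₁ A₀ g`,
`T₂ g = P₂ A₁ A₀ g`, each corrected by its (constant) mean so as to have zero mean on `T³`. [folklore] -/
def torusPrim (g : 𝕋³ → ℝ) (j : Fin 3) : 𝕋³ → ℝ :=
  ![fun ξ => circlePrim 0 g ξ - ∫ x, circlePrim 0 g x,
    fun ξ => circlePrim 1 (axisAvg 0 g) ξ - ∫ x, circlePrim 1 (axisAvg 0 g) x,
    fun ξ => circlePrim 2 (axisAvg 1 (axisAvg 0 g)) ξ -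
      ∫ x, circlePrim 2 (axisAvg 1 (axisAvg 0 g)) x] j

variable {g : 𝕋³ → ℝ}

/-- `T₀ g = P₀ g - ∫ P₀ g`. [folklore] -/
theorem torusPrim_zero (g : 𝕋³ → ℝ) :
    torusPrim g 0 = fun ξ => circlePrim 0 g ξ - ∫ x, circlePrim 0 g x := rfl

/-- `T₁ g = P₁ A₀ g - ∫ P₁ A₀ g`. [folklore] -/
theorem torusPrim_one (g : 𝕋³ → ℝ) :
    torusPrim g 1 = fun ξ => circlePrim 1 (axisAvg 0 g) ξ - ∫ x, circlePrim 1 (axisAvg 0 g) x :=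
  rfl

/-- `T₂ g = P₂ A₁ A₀ g - ∫ P₂ A₁ A₀ g`. [folklore] -/
theorem torusPrim_two (g : 𝕋³ → ℝ) :
    torusPrim g 2 = fun ξ => circlePrim 2 (axisAvg 1 (axisAvg 0 g)) ξ -
      ∫ x, circlePrim 2 (axisAvg 1 (axisAvg 0 g)) x :=
  rfl

/-! ### Translation invariance -/

/-- Axis averages commute with translations: `(A_k g)(ξ + v) = A_k (g(· + v)) (ξ)`. [folklore] -/
theorem axisAvg_add_right (k : Fin 3) (g : 𝕋³ → ℝ) (ξ v : 𝕋³) :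
    axisAvg k g (ξ + v) = axisAvg k (fun ζ => g (ζ + v)) ξ := by
  simp only [axisAvg_apply, add_right_comm]

/-- A translation invariance of `g` is inherited by its axis averages. [folklore] -/
theorem axisAvg_invariant (k : Fin 3) {v : 𝕋³} (h : ∀ ζ, g (ζ + v) = g ζ) (ξ : 𝕋³) :
    axisAvg k g (ξ + v) = axisAvg k g ξ := by
  rw [axisAvg_add_right]
  simp only [h]

/-- The triple average is invariant under each coordinate translation `ξ ↦ ξ + s eⱼ`
(`Torus.axisAvg_add_single`, transported through the outer averages). [folklore] -/
theorem tripleAvg_add_single (g : 𝕋³ → ℝ) (j : Fin 3) (ξ : 𝕋³) (s : UnitAddCircle) :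
    tripleAvg g (ξ + Pi.single j s) = tripleAvg g ξ := by
  unfold tripleAvg
  fin_cases j
  · exact axisAvg_invariant 2 (axisAvg_invariant 1 (fun ζ => axisAvg_add_single 0 g s ζ)) ξ
  · exact axisAvg_invariant 2 (fun ζ => axisAvg_add_single 1 (axisAvg 0 g) s ζ) ξ
  · exact axisAvg_add_single 2 _ s ξ

/-- Hence the triple average is a constant function. [folklore] -/
theorem tripleAvg_eq_tripleAvg_zero (g : 𝕋³ → ℝ) (ξ : 𝕋³) : tripleAvg g ξ = tripleAvg g 0 := by
  have hξ : ξ = (Pi.single (0 : Fin 3) (ξ 0) : 𝕋³) + (Pi.single (1 : Fin 3) (ξ 1) : 𝕋³) +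
      (Pi.single (2 : Fin 3) (ξ 2) : 𝕋³) := by
    conv_lhs => rw [← Finset.univ_sum_single ξ]
    rw [Fin.sum_univ_three]
  rw [hξ]
  calc tripleAvg g ((Pi.single (0 : Fin 3) (ξ 0) : 𝕋³) + (Pi.single (1 : Fin 3) (ξ 1) : 𝕋³) +
        (Pi.single (2 : Fin 3) (ξ 2) : 𝕋³))
      = tripleAvg g ((Pi.single (0 : Fin 3) (ξ 0) : 𝕋³) + (Pi.single (1 : Fin 3) (ξ 1) : 𝕋³)) :=
        tripleAvg_add_single g 2 _ _
    _ = tripleAvg g (Pi.single (0 : Fin 3) (ξ 0) : 𝕋³) := tripleAvg_add_single g 1 _ _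
    _ = tripleAvg g ((0 : 𝕋³) + (Pi.single (0 : Fin 3) (ξ 0) : 𝕋³)) := by rw [zero_add]
    _ = tripleAvg g 0 := tripleAvg_add_single g 0 0 _

end Operators

/-! ## The fundamental identity `∂ⱼ P_j g = g - A_j g` -/

section FTC

/-- **One-dimensional core**: for a continuous `1`-periodic `φ`, the function
`t ↦ ∫₀¹ (s - ½) φ(t + s) ds` has derivative `φ(0) - ∫₀¹ φ` at `t = 0` (write it as
`Ψ(1+t) - Ψ(t) - (t + ½)∫₀¹φ` with `Ψ(u) = ∫₀ᵘ r φ(r) dr`, and use `φ(1) = φ(0)`). [folklore] -/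
theorem hasDerivAt_integral_sub_half_mul {φ : ℝ → ℝ} (hφ : Continuous φ)
    (hper : Function.Periodic φ 1) :
    HasDerivAt (fun t => ∫ s in (0 : ℝ)..1, (s - 1 / 2) * φ (t + s))
      (φ 0 - ∫ s in (0 : ℝ)..1, φ s) 0 := by
  set m : ℝ := ∫ s in (0 : ℝ)..1, φ s with hm
  set Ψ : ℝ → ℝ := fun u => ∫ r in (0 : ℝ)..u, r * φ r with hΨ
  have hcont : Continuous fun r : ℝ => r * φ r := continuous_id.mul hφ
  have hint : ∀ a b : ℝ, IntervalIntegrable (fun r : ℝ => r * φ r) volume a b := fun a b =>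
    hcont.intervalIntegrable a b
  -- the closed form
  have heq : (fun t => ∫ s in (0 : ℝ)..1, (s - 1 / 2) * φ (t + s)) =
      fun t => Ψ (1 + t) - Ψ t - (t + 1 / 2) * m := by
    funext t
    have h1 : (fun s : ℝ => (s - 1 / 2) * φ (t + s)) =
        fun s => (fun r : ℝ => r * φ r - (t + 1 / 2) * φ r) (s + t) := by
      funext s
      rw [add_comm t s]
      ring
    have hp : ∫ r in t..1 + t, φ r = m := by
      rw [show (1 : ℝ) + t = t + 1 by ring, hper.intervalIntegral_add_eq t 0, zero_add]
    have hc2 : Continuous fun r : ℝ => (t + 1 / 2) * φ r := continuous_const.mul hφ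
    have hint2 : IntervalIntegrable (fun r : ℝ => (t + 1 / 2) * φ r) volume t (1 + t) :=
      hc2.intervalIntegrable _ _
    rw [h1, intervalIntegral.integral_comp_add_right (fun r : ℝ => r * φ r - (t + 1 / 2) * φ r) t,
      zero_add, intervalIntegral.integral_sub (hint _ _) hint2,
      intervalIntegral.integral_const_mul, hp,
      ← intervalIntegral.integral_interval_sub_left (hint 0 (1 + t)) (hint 0 t)]
  -- differentiate the closed form
  have hΨ' : ∀ u : ℝ, HasDerivAt Ψ (u * φ u) u := fun u =>
    (hcont.integral_hasStrictDerivAt 0 u).hasDerivAt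
  have hd1 : HasDerivAt (fun t : ℝ => Ψ (1 + t)) ((1 + 0) * φ (1 + 0)) 0 :=
    HasDerivAt.comp_const_add 1 0 (hΨ' (1 + 0))
  have hd2 : HasDerivAt (fun t : ℝ => (t + 1 / 2) * m) (1 * m) 0 :=
    ((hasDerivAt_id (0 : ℝ)).add_const (1 / 2)).mul_const m
  have hd : HasDerivAt (fun t => Ψ (1 + t) - Ψ t - (t + 1 / 2) * m)
      ((1 + 0) * φ (1 + 0) - 0 * φ 0 - 1 * m) 0 := (hd1.sub (hΨ' 0)).sub hd2
  rw [heq]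
  refine hd.congr_deriv ?_
  have h10 : φ 1 = φ 0 := by simpa using hper 0
  simp only [add_zero, one_mul, zero_mul, sub_zero, h10]

variable {g : 𝕋³ → ℝ}

/-- **`∂ⱼ (P_j g) = g - A_j g`** for continuous `g` on `T³` (`A_j = Torus.axisAvg j`): the
fundamental theorem of calculus over one period of the `j`-th coordinate circle. [folklore] -/
theorem partialDeriv_circlePrim (hg : Continuous g) (j : Fin 3) (ξ : 𝕋³) :
    partialDeriv j (circlePrim j g) ξ = g ξ - axisAvg j g ξ := by
  set φ : ℝ → ℝ := fun r => g (ξ + proj (r • bvec j)) with hφdef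
  have hφ : Continuous φ := continuous_comp_circle hg j ξ
  have hper : Function.Periodic φ 1 := periodic_comp_circle g j ξ
  have key := hasDerivAt_integral_sub_half_mul hφ hper
  have hF : (fun t : ℝ => circlePrim j g (ξ + proj (t • bvec j))) =
      fun t => ∫ s in (0 : ℝ)..1, (s - 1 / 2) * φ (t + s) := by
    funext t
    simp only [circlePrim, hφdef, add_assoc, ← proj_add, ← add_smul]
  have h0 : φ 0 = g ξ := by simp [hφdef]
  change Torus.lineDeriv (circlePrim j g) ξ (bvec j) = _
  unfold Torus.lineDeriv
  rw [hF, key.deriv, h0, axisAvg_eq_intervalIntegral]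

/-- `∂ⱼ (f - c) = ∂ⱼ f` for a constant `c`. [folklore] -/
theorem partialDeriv_sub_const (f : 𝕋³ → ℝ) (c : ℝ) (j : Fin 3) (x : 𝕋³) :
    partialDeriv j (fun y => f y - c) x = partialDeriv j f x := by
  change Torus.lineDeriv (fun y => f y - c) x _ = Torus.lineDeriv f x _
  unfold Torus.lineDeriv
  exact deriv_sub_const c

end FTC

/-! ## Smoothness of the operators -/

section Smoothness

/-- **Joint smoothness** of a matrix-parametrised family `u : ℝ^{3×3} → (T³ → ℝ)`: the map
`(R, y) ↦ u R (proj y)` is `C^∞` on `ℝ^{3×3} × ℝ³` (the smoothness asked of Mikado profiles,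
`BDSV.MikadoDatum.smooth_W`). [folklore] -/
def JointSmooth (u : 𝕄 → 𝕋³ → ℝ) : Prop :=
  ContDiff ℝ ∞ fun p : 𝕄 × ℝ³ => u p.1 (proj p.2)

variable {g : 𝕋³ → ℝ} {u v : 𝕄 → 𝕋³ → ℝ}

/-- Each member of a jointly smooth family is smooth on `T³`. [folklore] -/
theorem JointSmooth.isSmooth (hu : JointSmooth u) (R : 𝕄) : IsSmooth (u R) :=
  hu.comp (contDiff_prodMk_right R)

/-- A jointly smooth family is continuous in both variables. [folklore] -/
theorem JointSmooth.continuous (hu : JointSmooth u) : Continuous fun p : 𝕄 × 𝕋³ => u p.1 p.2 := by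
  have h : Continuous fun p : 𝕄 × ℝ³ => u p.1 (proj p.2) := ContDiff.continuous hu
  have hq : IsOpenQuotientMap (Prod.map id proj : 𝕄 × ℝ³ → 𝕄 × 𝕋³) :=
    IsOpenQuotientMap.id.prodMap isOpenQuotientMap_proj
  exact hq.continuous_comp_iff.1 h

/-- A smooth function of `ξ` alone is a jointly smooth (constant-in-`R`) family. [folklore] -/
theorem JointSmooth.of_isSmooth (hg : IsSmooth g) : JointSmooth fun _ => g :=
  hg.comp contDiff_snd

/-- A smooth function of `R` alone is a jointly smooth (constant-in-`ξ`) family. [folklore] -/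
theorem JointSmooth.of_contDiff {c : 𝕄 → ℝ} (hc : ContDiff ℝ ∞ c) : JointSmooth fun R _ => c R :=
  hc.comp contDiff_fst

/-- Sums of jointly smooth families are jointly smooth. [folklore] -/
theorem JointSmooth.add (hu : JointSmooth u) (hv : JointSmooth v) :
    JointSmooth fun R ξ => u R ξ + v R ξ :=
  ContDiff.add hu hv

/-- Differences of jointly smooth families are jointly smooth. [folklore] -/
theorem JointSmooth.sub (hu : JointSmooth u) (hv : JointSmooth v) :
    JointSmooth fun R ξ => u R ξ - v R ξ :=
  ContDiff.sub hu hv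

/-- Products of jointly smooth families are jointly smooth. [folklore] -/
theorem JointSmooth.mul (hu : JointSmooth u) (hv : JointSmooth v) :
    JointSmooth fun R ξ => u R ξ * v R ξ :=
  ContDiff.mul hu hv

/-- Circle primitives of smooth functions are smooth. [folklore] -/
theorem isSmooth_circlePrim (hg : IsSmooth g) (j : Fin 3) : IsSmooth (circlePrim j g) := by
  have hH : ContDiff ℝ ∞ fun q : ℝ × ℝ³ => (q.1 - 1 / 2) * lift g (q.2 + q.1 • bvec j) :=
    (contDiff_fst.sub contDiff_const).mul
      (hg.comp (contDiff_snd.add (contDiff_fst.smul contDiff_const)))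
  have h := contDiff_parametric_intervalIntegral hH 0 1
  have heq : lift (circlePrim j g) =
      fun y : ℝ³ => ∫ s in (0 : ℝ)..1, (s - 1 / 2) * lift g (y + s • bvec j) := by
    funext y
    simp only [lift_apply, circlePrim, proj_add]
  unfold IsSmooth
  rw [heq]
  exact h

/-- The triple average of a smooth function is smooth (`Torus.IsSmooth.axisAvg`). [folklore] -/
theorem isSmooth_tripleAvg (hg : IsSmooth g) : IsSmooth (tripleAvg g) :=
  ((hg.axisAvg 0).axisAvg 1).axisAvg 2

/-- Parametrised axis averages of a jointly smooth family are jointly smooth (the interval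
form `Torus.lift_axisAvg` and smooth dependence of interval integrals on parameters). [folklore] -/
theorem JointSmooth.axisAvg (hu : JointSmooth u) (j : Fin 3) :
    JointSmooth fun R => Torus.axisAvg j (u R) := by
  have hH : ContDiff ℝ ∞ fun q : ℝ × (𝕄 × ℝ³) =>
      (fun p : 𝕄 × ℝ³ => u p.1 (proj p.2)) (q.2.1, q.2.2 + q.1 • bvec j) :=
    hu.comp (contDiff_snd.fst.prodMk (contDiff_snd.snd.add (contDiff_fst.smul contDiff_const)))
  have h := contDiff_parametric_intervalIntegral hH 0 1
  have heq : (fun p : 𝕄 × ℝ³ => Torus.axisAvg j (u p.1) (proj p.2)) =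
      fun p => ∫ s in (0 : ℝ)..1, u p.1 (proj (p.2 + s • bvec j)) := by
    funext p
    rw [axisAvg_eq_intervalIntegral]
    simp only [proj_add]
  unfold JointSmooth
  rw [heq]
  exact h

/-- Parametrised circle primitives of a jointly smooth family are jointly smooth. [folklore] -/
theorem JointSmooth.circlePrim (hu : JointSmooth u) (j : Fin 3) :
    JointSmooth fun R => BDSV.circlePrim j (u R) := by
  have hH : ContDiff ℝ ∞ fun q : ℝ × (𝕄 × ℝ³) =>
      (q.1 - 1 / 2) * (fun p : 𝕄 × ℝ³ => u p.1 (proj p.2)) (q.2.1, q.2.2 + q.1 • bvec j) :=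
    (contDiff_fst.sub contDiff_const).mul
      (hu.comp (contDiff_snd.fst.prodMk (contDiff_snd.snd.add (contDiff_fst.smul contDiff_const))))
  have h := contDiff_parametric_intervalIntegral hH 0 1
  have heq : (fun p : 𝕄 × ℝ³ => BDSV.circlePrim j (u p.1) (proj p.2)) =
      fun p => ∫ s in (0 : ℝ)..1, (s - 1 / 2) * u p.1 (proj (p.2 + s • bvec j)) := by
    funext p
    simp only [BDSV.circlePrim, proj_add]
  unfold JointSmooth
  rw [heq]
  exact h

/-- **Torus integrals of a jointly smooth family depend smoothly on the parameter**
(differentiation under the integral sign over the compact torus, through the measurable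
fundamental-domain representative `Torus.repr`). [folklore] -/
theorem JointSmooth.contDiff_integral (hu : JointSmooth u) : ContDiff ℝ ∞ fun R => ∫ x, u R x := by
  have hG : ContDiff ℝ ∞ fun q : ℝ³ × 𝕄 => u q.2 (proj q.1) :=
    hu.comp (contDiff_snd.prodMk contDiff_fst)
  have h := contDiff_parametric_integral (μ := (volume : Measure 𝕋³)) measurable_repr
    isCompact_toLp_image_pi_Icc (Eventually.of_forall repr_mem_toLp_image_pi_Icc) hG
  simpa only [proj_repr] using h

/-- The zero-mean primitives `R ↦ torusPrim (u R) j` of a jointly smooth family are jointly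
smooth. [folklore] -/
theorem JointSmooth.torusPrim (hu : JointSmooth u) (j : Fin 3) :
    JointSmooth fun R => BDSV.torusPrim (u R) j := by
  fin_cases j
  · exact (hu.circlePrim 0).sub (JointSmooth.of_contDiff (hu.circlePrim 0).contDiff_integral)
  · exact ((hu.axisAvg 0).circlePrim 1).sub
      (JointSmooth.of_contDiff ((hu.axisAvg 0).circlePrim 1).contDiff_integral)
  · exact (((hu.axisAvg 0).axisAvg 1).circlePrim 2).sub
      (JointSmooth.of_contDiff (((hu.axisAvg 0).axisAvg 1).circlePrim 2).contDiff_integral)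

/-- The zero-mean primitives of a smooth function are smooth. [folklore] -/
theorem isSmooth_torusPrim (hg : IsSmooth g) (j : Fin 3) : IsSmooth (torusPrim g j) :=
  ((JointSmooth.of_isSmooth hg).torusPrim j).isSmooth 0

end Smoothness

/-! ## The telescoping decomposition -/

section Decomposition

variable {g : 𝕋³ → ℝ}

/-- **The triple average is the mean**: `A₂ A₁ A₀ g ≡ ∫_{T³} g` for smooth `g` (it is constant,
and `g - A₂A₁A₀ g = ∂₀ P₀ g + ∂₁ P₁ A₀ g + ∂₂ P₂ A₁ A₀ g` integrates to zero over the torus). [folklore] -/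
theorem tripleAvg_eq_integral (hg : IsSmooth g) (ξ : 𝕋³) : tripleAvg g ξ = ∫ x, g x := by
  have hc0 : Continuous g := hg.continuous
  have hc1 : Continuous (axisAvg 0 g) := (hg.axisAvg 0).continuous
  have hc2 : Continuous (axisAvg 1 (axisAvg 0 g)) := ((hg.axisAvg 0).axisAvg 1).continuous
  have hconst : ∀ x, tripleAvg g x = tripleAvg g 0 := tripleAvg_eq_tripleAvg_zero g
  have hs0 : IsSmooth (circlePrim 0 g) := isSmooth_circlePrim hg 0
  have hs1 : IsSmooth (circlePrim 1 (axisAvg 0 g)) := isSmooth_circlePrim (hg.axisAvg 0) 1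
  have hs2 : IsSmooth (circlePrim 2 (axisAvg 1 (axisAvg 0 g))) :=
    isSmooth_circlePrim ((hg.axisAvg 0).axisAvg 1) 2
  have htel : (fun x => g x) = fun x => tripleAvg g 0 +
      ((partialDeriv 0 (circlePrim 0 g) x + partialDeriv 1 (circlePrim 1 (axisAvg 0 g)) x) +
        partialDeriv 2 (circlePrim 2 (axisAvg 1 (axisAvg 0 g))) x) := by
    funext x
    rw [partialDeriv_circlePrim hc0, partialDeriv_circlePrim hc1, partialDeriv_circlePrim hc2,
      ← hconst x, tripleAvg]
    ring
  have hi0 : Integrable (fun x => partialDeriv 0 (circlePrim 0 g) x) := (hs0.partialDeriv 0).integrable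
  have hi1 : Integrable (fun x => partialDeriv 1 (circlePrim 1 (axisAvg 0 g)) x) :=
    (hs1.partialDeriv 1).integrable
  have hi2 : Integrable (fun x => partialDeriv 2 (circlePrim 2 (axisAvg 1 (axisAvg 0 g))) x) :=
    (hs2.partialDeriv 2).integrable
  have hi01 : Integrable (fun x => partialDeriv 0 (circlePrim 0 g) x +
      partialDeriv 1 (circlePrim 1 (axisAvg 0 g)) x) := hi0.add hi1
  have hi012 : Integrable (fun x => partialDeriv 0 (circlePrim 0 g) x +
      partialDeriv 1 (circlePrim 1 (axisAvg 0 g)) x +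
      partialDeriv 2 (circlePrim 2 (axisAvg 1 (axisAvg 0 g))) x) := hi01.add hi2
  rw [hconst ξ, htel, integral_add (integrable_const _) hi012, integral_add hi01 hi2,
    integral_add hi0 hi1, integral_partialDeriv_eq_zero_holds hs0 0,
    integral_partialDeriv_eq_zero_holds hs1 1, integral_partialDeriv_eq_zero_holds hs2 2]
  simp

/-- **Telescoping decomposition of a smooth zero-mean function on `T³`**:
`g = ∑ⱼ ∂ⱼ (Tⱼ g)` with the smooth zero-mean functions `Tⱼ g = BDSV.torusPrim g j`
(`g = (g - A₀g) + (A₀g - A₁A₀g) + (A₁A₀g - A₂A₁A₀g)`, `A₂A₁A₀ g = ∫g = 0`, and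
`∂ⱼ P_j = 1 - A_j`). This replaces the Fourier expansion `∑_{k≠0} C_k e^{ik·ξ}` of a mean-free
profile in the proof of BDSV Prop. 6.2. [folklore] -/
theorem eq_sum_partialDeriv_torusPrim (hg : IsSmooth g) (h0 : ∫ x, g x = 0) (ξ : 𝕋³) :
    g ξ = ∑ j, partialDeriv j (torusPrim g j) ξ := by
  have hc0 : Continuous g := hg.continuous
  have hc1 : Continuous (axisAvg 0 g) := (hg.axisAvg 0).continuous
  have hc2 : Continuous (axisAvg 1 (axisAvg 0 g)) := ((hg.axisAvg 0).axisAvg 1).continuous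
  rw [Fin.sum_univ_three, torusPrim_zero, torusPrim_one, torusPrim_two, partialDeriv_sub_const,
    partialDeriv_sub_const, partialDeriv_sub_const, partialDeriv_circlePrim hc0,
    partialDeriv_circlePrim hc1, partialDeriv_circlePrim hc2]
  have h := tripleAvg_eq_integral hg ξ
  rw [h0, tripleAvg] at h
  linarith

/-- The primitives `Tⱼ g` have zero mean. [folklore] -/
theorem integral_torusPrim (hg : IsSmooth g) (j : Fin 3) : ∫ x, torusPrim g j x = 0 := by
  have key : ∀ {h : 𝕋³ → ℝ}, IsSmooth h → ∫ x, (h x - ∫ y, h y) = 0 := by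
    intro h hh
    rw [integral_sub hh.integrable (integrable_const _)]
    simp
  fin_cases j
  · exact key (isSmooth_circlePrim hg 0)
  · exact key (isSmooth_circlePrim (hg.axisAvg 0) 1)
  · exact key (isSmooth_circlePrim ((hg.axisAvg 0).axisAvg 1) 2)

end Decomposition

/-! ## Derivatives in `ξ` and in the parameter `R` -/

section Derivatives

/-- The `k`-th `ξ`-partial derivative of a parametrised family, `(∂_{ξ_k} u)(R, ξ)`. [folklore] -/
def dXi (k : Fin 3) (u : 𝕄 → 𝕋³ → ℝ) : 𝕄 → 𝕋³ → ℝ := fun R ξ => partialDeriv k (u R) ξ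

/-- The derivative of a parametrised family in the parameter direction `E ∈ ℝ^{3×3}`,
`(∂_R u · E)(R, ξ)`. [folklore] -/
def dR (E : 𝕄) (u : 𝕄 → 𝕋³ → ℝ) : 𝕄 → 𝕋³ → ℝ := fun R ξ => fderiv ℝ (fun R' => u R' ξ) R E

variable {u : 𝕄 → 𝕋³ → ℝ}

/-- The `ξ`-derivative of a jointly smooth family, through the joint lift:
`(∂_{ξ_k} u)(R, proj y) = D û (R, y) (0, e_k)`. [folklore] -/
theorem JointSmooth.dXi_apply (hu : JointSmooth u) (k : Fin 3) (R : 𝕄) (y : ℝ³) :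
    BDSV.dXi k u R (proj y) = fderiv ℝ (fun p : 𝕄 × ℝ³ => u p.1 (proj p.2)) (R, y) (0, bvec k) := by
  have h1 : IsContDiff 1 (u R) := (hu.isSmooth R).isContDiff (by simp)
  have h2 : HasFDerivAt (lift (u R)) ((fderiv ℝ (fun p : 𝕄 × ℝ³ => u p.1 (proj p.2)) (R, y)).comp
      (ContinuousLinearMap.inr ℝ 𝕄 ℝ³)) y :=
    hasFDerivAt_comp_prodMk_right hu (by simp) R y
  rw [BDSV.dXi, partialDeriv_eq_fderiv_apply h1, ← fderiv_lift, h2.fderiv]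
  rfl

/-- `ξ`-derivatives of a jointly smooth family are jointly smooth. [folklore] -/
theorem JointSmooth.dXi (hu : JointSmooth u) (k : Fin 3) : JointSmooth (BDSV.dXi k u) := by
  have heq : (fun p : 𝕄 × ℝ³ => BDSV.dXi k u p.1 (proj p.2)) =
      fun p => fderiv ℝ (fun p : 𝕄 × ℝ³ => u p.1 (proj p.2)) p (0, bvec k) := by
    funext p
    exact hu.dXi_apply k p.1 p.2
  unfold JointSmooth
  rw [heq]
  exact (hu.fderiv_right le_rfl).clm_apply contDiff_const

/-- The `R`-derivative of a jointly smooth family, through the joint lift: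
`(∂_R u · E)(R, proj y) = D û (R, y) (E, 0)`. [folklore] -/
theorem JointSmooth.dR_apply (hu : JointSmooth u) (E R : 𝕄) (y : ℝ³) :
    BDSV.dR E u R (proj y) = fderiv ℝ (fun p : 𝕄 × ℝ³ => u p.1 (proj p.2)) (R, y) (E, 0) := by
  have h2 : HasFDerivAt (fun R' : 𝕄 => u R' (proj y))
      ((fderiv ℝ (fun p : 𝕄 × ℝ³ => u p.1 (proj p.2)) (R, y)).comp
        (ContinuousLinearMap.inl ℝ 𝕄 ℝ³)) R :=
    hasFDerivAt_comp_prodMk_left hu (by simp) R y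
  rw [BDSV.dR, h2.fderiv]
  rfl

/-- `R`-derivatives of a jointly smooth family are jointly smooth. [folklore] -/
theorem JointSmooth.dR (hu : JointSmooth u) (E : 𝕄) : JointSmooth (BDSV.dR E u) := by
  have heq : (fun p : 𝕄 × ℝ³ => BDSV.dR E u p.1 (proj p.2)) =
      fun p => fderiv ℝ (fun p : 𝕄 × ℝ³ => u p.1 (proj p.2)) p (E, 0) := by
    funext p
    exact hu.dR_apply E p.1 p.2
  unfold JointSmooth
  rw [heq]
  exact (hu.fderiv_right le_rfl).clm_apply contDiff_const

/-- **`R`-derivatives of a zero-mean family have zero mean** (the mean `R ↦ ∫ u R` is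
differentiable with derivative `∫ ∂_R u`, by differentiation under the integral sign over the
compact torus; it vanishes identically, hence so does its derivative). [folklore] -/
theorem JointSmooth.integral_dR (hu : JointSmooth u) (h0 : ∀ R, ∫ ξ, u R ξ = 0) (E R : 𝕄) :
    ∫ ξ, BDSV.dR E u R ξ = 0 := by
  have hG : ContDiff ℝ ∞ fun q : ℝ³ × 𝕄 => u q.2 (proj q.1) :=
    hu.comp (contDiff_snd.prodMk contDiff_fst)
  have key := fderiv_parametric_integral_apply (μ := (volume : Measure 𝕋³)) measurable_repr
    isCompact_toLp_image_pi_Icc (Eventually.of_forall repr_mem_toLp_image_pi_Icc) hG (by simp) R E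
  have hzero : (fun p : 𝕄 => ∫ w : 𝕋³, (fun q : ℝ³ × 𝕄 => u q.2 (proj q.1)) (repr w, p)) =
      fun _ => (0 : ℝ) := by
    funext p
    simp only [proj_repr]
    exact h0 p
  rw [hzero] at key
  have hz' : fderiv ℝ (fun _ : 𝕄 => (0 : ℝ)) R E = 0 := by simp
  replace key := hz'.symm.trans key
  have h2 : ∀ w : 𝕋³,
      fderiv ℝ (fun q : ℝ³ × 𝕄 => u q.2 (proj q.1)) (repr w, R) (0, E) = BDSV.dR E u R w := by
    intro w
    have h3 : HasFDerivAt (fun R' : 𝕄 => u R' w)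
        ((fderiv ℝ (fun q : ℝ³ × 𝕄 => u q.2 (proj q.1)) (repr w, R)).comp
          (ContinuousLinearMap.inr ℝ ℝ³ 𝕄)) R := by
      have h4 := hasFDerivAt_comp_prodMk_right hG (by simp) (repr w) R
      simp only [proj_repr] at h4
      exact h4
    rw [BDSV.dR, h3.fderiv]
    rfl
  have h5 : ∫ w : 𝕋³, fderiv ℝ (fun q : ℝ³ × 𝕄 => u q.2 (proj q.1)) (repr w, R) (0, E) =
      ∫ w, BDSV.dR E u R w :=
    integral_congr_ae (Eventually.of_forall h2)
  exact (key.trans h5).symm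

end Derivatives

end BDSV

end Literature.Analysis.FluidPDE
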